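import Mathlib
import Literature.NumberTheory.Automorphic.GaloisActionPlaces
import Literature.NumberTheory.Automorphic.AutomorphicInductionCharacterCubic
import Summits.Langlands.Langlands.Theorems.PicardMuOrdinaryResidualAutomorphyEvenDatum
import Summits.Langlands.Langlands.Theorems.IrregularClassicality.Negative.StationaryCollapse

/-!
# `ResidualAutomorphyEven` at weight `0`: the route decl with `IsRegularAlgebraic` deleted, granted
# cubic automorphic induction (JPSS 1979)

Helper file for item stmt-Langlands-13760 (route `PicardMuOrdinary`).  The route decl
`Summit.Langlands.Langlands.Theses.PicardMuOrdinary.ResidualAutomorphyEven` asks for a cuspidal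
automorphic representation `P` of `GL₃(𝔸_K)`, `K = ℚ(ω)`, a maximal ideal `𝔐 ∋ 3` of
`ℤ̄ = integralClosure ℤ ℂ`, and for almost every `𝔭` a Satake parameter `α` of `P` at `𝔭` and
`Q ∈ ℤ̄[X]` with `Q = ∏_{a ∈ α} (X - N𝔭 · a)` in `ℂ[X]` and `Q ≡ T(f, 𝔭) (mod 𝔐)` — AND that `P` be
regular algebraic.  Here we prove, CONDITIONALLY on the tree's named fact
`automorphicInduction_character_cubic` (Jacquet–Piatetski-Shapiro–Shalika 1979 II), the same statement
with the regularity clause removed (`residualAutomorphyEven_weightZero`): `P = AI_{E/K}(ε)` from the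
`Datum` file has Satake polynomial `T(f, 𝔭) ∈ ℤ[X]` (monic) at almost every `𝔭` (and a maximal ideal
`𝔐 ∋ 3` of `ℤ̄` exists: the tree's `IrregularClassicality.Negative.exists_isMaximal_three_mem`); its roots `a` are
algebraic integers, so is `N𝔭 · a`, and `N𝔭 ≡ 1 (mod 3)` for `𝔭 ∤ 3` (the residue field of `𝔭`
contains a primitive cube root of unity), whence `∏ (X - N𝔭 · a) ≡ ∏ (X - a) = T(f, 𝔭) (mod 𝔐)`.

What this does NOT give: `IsRegularAlgebraic` — `AI(ε)` has archimedean exponents `{0, 0, 0}`; the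
regular-algebraic `P` of the decl needs an algebraic Hecke character of the CM field `E` of regular
infinity type in place of `ε` and an archimedean clause for non-normal cubic automorphic induction,
neither available in the tree (see the item notes).
-/

set_option linter.dupNamespace false -- project-wide option (lakefile weak.linter.dupNamespace); `Summit.Langlands.Langlands` is the mandated namespace

noncomputable section

namespace Summit.Langlands.Langlands.Theorems.ResidualAutomorphyEven

open Polynomial Equiv Finset NumberField Pairing IsDedekindDomain Filter
open Literature.NumberTheory.GaloisRepresentations Literature.NumberTheory.Automorphic
  Literature.NumberTheory.QuadraticForms
open scoped Classical

variable {f : ℤ[X]}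

/-! ### `ℤ̄ = integralClosure ℤ ℂ`: integral lifts (a maximal ideal above `3` is the tree's
`IrregularClassicality.Negative.exists_isMaximal_three_mem`) -/

/-- An integral lift `ℂ → ℤ̄` (the identity on algebraic integers, `0` elsewhere). -/
def zlift (a : ℂ) : integralClosure ℤ ℂ := if h : IsIntegral ℤ a then ⟨a, h⟩ else 0

/-- `zlift a = a` for `a` an algebraic integer. -/
theorem algebraMap_zlift {a : ℂ} (h : IsIntegral ℤ a) : algebraMap (integralClosure ℤ ℂ) ℂ (zlift a) = a := by
  rw [zlift, dif_pos h]; rfl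

/-- `ℤ → ℤ̄ → ℂ` is the cast. -/
theorem algebraMap_comp_castRingHom :
    (algebraMap (integralClosure ℤ ℂ) ℂ).comp (Int.castRingHom (integralClosure ℤ ℂ)) = Int.castRingHom ℂ :=
  RingHom.ext_int _ _

/-- **The Hecke polynomial at weight `0` is integral and congruent to the Satake polynomial.**  If
`∏_{a ∈ α} (X - a) = T` for a monic `T ∈ ℤ[X]` and `q ≡ 1 (mod 𝔐)`, then
`Q = ∏_{a ∈ α} (X - q a)` lies in `ℤ̄[X]` and `Q ≡ T (mod 𝔐)`. -/
theorem exists_Q_of_satakePolynomial_eq {T : ℤ[X]} (hT : T.Monic) {α : Multiset ℂ}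
    (hα : satakePolynomial α = T.map (Int.castRingHom ℂ)) (𝔐 : Ideal (integralClosure ℤ ℂ)) {q : ℕ}
    (hq : ((q : integralClosure ℤ ℂ) - 1) ∈ 𝔐) :
    ∃ Q : Polynomial (integralClosure ℤ ℂ),
      Q.map (algebraMap (integralClosure ℤ ℂ) ℂ) = (α.map fun a => X - C ((q : ℂ) * a)).prod ∧
      Q.map (Ideal.Quotient.mk 𝔐) = T.map (Int.castRingHom (integralClosure ℤ ℂ ⧸ 𝔐)) := by
  -- the `a ∈ α` are roots of the monic integer polynomial `T`, hence algebraic integers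
  have hint : ∀ a ∈ α, IsIntegral ℤ a := by
    intro a ha
    have hroot : a ∈ (T.map (Int.castRingHom ℂ)).roots := by rw [← hα, roots_satakePolynomial]; exact ha
    have heval := (mem_roots (hT.map _).ne_zero).mp hroot
    refine ⟨T, hT, ?_⟩
    rw [IsRoot.def, eval_map] at heval
    rwa [algebraMap_int_eq]
  -- the lift of `∏ (X - a)` to `ℤ̄[X]` is `T`
  have hP : ((α.map zlift).map fun b => X - C b).prod = T.map (Int.castRingHom (integralClosure ℤ ℂ)) := by
    apply Polynomial.map_injective (algebraMap (integralClosure ℤ ℂ) ℂ) Subtype.val_injective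
    rw [Polynomial.map_map, algebraMap_comp_castRingHom, ← hα, satakePolynomial, Polynomial.map_multiset_prod,
      Multiset.map_map, Multiset.map_map]
    congr 1
    refine Multiset.map_congr rfl fun a ha => ?_
    rw [Function.comp_apply, Function.comp_apply, Polynomial.map_sub, Polynomial.map_X, Polynomial.map_C,
      algebraMap_zlift (hint a ha)]
  -- `q ≡ 1 (mod 𝔐)` and `ℤ → ℤ̄ → ℤ̄/𝔐`
  have hq1 : Ideal.Quotient.mk 𝔐 (q : integralClosure ℤ ℂ) = 1 := by
    rw [← sub_eq_zero, ← map_one (Ideal.Quotient.mk 𝔐), ← map_sub, Ideal.Quotient.eq_zero_iff_mem]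
    exact hq
  have hcomp : (Ideal.Quotient.mk 𝔐).comp (Int.castRingHom (integralClosure ℤ ℂ)) =
      Int.castRingHom (integralClosure ℤ ℂ ⧸ 𝔐) := RingHom.ext_int _ _
  refine ⟨((α.map zlift).map fun b => X - C ((q : integralClosure ℤ ℂ) * b)).prod, ?_, ?_⟩
  · rw [Polynomial.map_multiset_prod, Multiset.map_map, Multiset.map_map]
    congr 1
    refine Multiset.map_congr rfl fun a ha => ?_
    rw [Function.comp_apply, Function.comp_apply, Polynomial.map_sub, Polynomial.map_X, Polynomial.map_C,
      map_mul, map_natCast, algebraMap_zlift (hint a ha)]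
  · rw [← hcomp, ← Polynomial.map_map, ← hP, Polynomial.map_multiset_prod, Polynomial.map_multiset_prod]
    simp only [Multiset.map_map]
    refine congrArg _ (Multiset.map_congr rfl fun a _ => ?_)
    simp only [Function.comp_apply]
    rw [Polynomial.map_sub, Polynomial.map_sub, Polynomial.map_X, Polynomial.map_C, Polynomial.map_C, map_mul, hq1,
      one_mul]

/-! ### `N𝔭 ≡ 1 (mod 3)` for `𝔭 ∤ 3` in `K = ℚ(ω)` -/

/-- **`3 ∣ N𝔭 - 1` for a prime `𝔭 ∤ 3` of `K = ℚ(ω)`**: the residue field `k_𝔭` (of order `N𝔭`) contains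
the reduction of a primitive cube root of unity `ζ`, which is `≠ 1` (as `ζ² + ζ + 1 = 0` and `3 ∉ 𝔭`),
an element of order `3` of `k_𝔭ˣ`. -/
theorem three_dvd_residueCard_sub_one (v : HeightOneSpectrum (𝓞 K)) (h3 : (3 : 𝓞 K) ∉ v.asIdeal) :
    3 ∣ v.residueCard - 1 := by
  haveI : IsCyclotomicExtension {3} ℚ (CyclotomicField 3 ℚ) := CyclotomicField.isCyclotomicExtension 3 ℚ
  have hζ := IsCyclotomicExtension.zeta_spec 3 ℚ K
  set ζ : 𝓞 K := hζ.toInteger with hζdef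
  have hζ' : IsPrimitiveRoot ζ 3 := hζ.toInteger_isPrimitiveRoot
  -- `ζ² + ζ + 1 = 0` in `𝓞 K`
  have hζ1 : ζ ≠ 1 := hζ'.ne_one (by norm_num)
  have hsum : ζ ^ 2 + ζ + 1 = 0 := by
    have h3 : ζ ^ 3 = 1 := hζ'.pow_eq_one
    have : (ζ - 1) * (ζ ^ 2 + ζ + 1) = 0 := by ring_nf; linear_combination h3
    rcases mul_eq_zero.mp this with h | h
    · exact absurd (sub_eq_zero.mp h) hζ1
    · exact h
  -- in the residue field
  haveI := v.isMaximal
  letI : Field (𝓞 K ⧸ v.asIdeal) := Ideal.Quotient.field v.asIdeal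
  haveI : Finite (𝓞 K ⧸ v.asIdeal) := Ideal.finiteQuotientOfFreeOfNeBot _ v.ne_bot
  letI : Fintype (𝓞 K ⧸ v.asIdeal) := Fintype.ofFinite _
  set z : 𝓞 K ⧸ v.asIdeal := Ideal.Quotient.mk v.asIdeal ζ with hz
  have hz3 : z ^ 3 = 1 := by rw [hz, ← map_pow, hζ'.pow_eq_one, map_one]
  have hz1 : z ≠ 1 := by
    intro h1
    apply h3
    have h0 : Ideal.Quotient.mk v.asIdeal (ζ ^ 2 + ζ + 1) = 0 := by rw [hsum, map_zero]
    rw [map_add, map_add, map_pow, map_one, ← hz, h1, one_pow] at h0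
    have : Ideal.Quotient.mk v.asIdeal (3 : 𝓞 K) = 0 := by rw [map_ofNat]; norm_num at h0 ⊢; exact h0
    exact Ideal.Quotient.eq_zero_iff_mem.mp this
  -- `z` is a unit of order `3`, so `3 ∣ #k_𝔭ˣ = N𝔭 - 1`
  have hz0 : z ≠ 0 := fun h0 => by rw [h0, zero_pow (by norm_num)] at hz3; exact zero_ne_one hz3
  set u : (𝓞 K ⧸ v.asIdeal)ˣ := Units.mk0 z hz0 with hu
  have hu3 : u ^ 3 = 1 := Units.ext (by rw [Units.val_pow_eq_pow_val, Units.val_mk0, hz3, Units.val_one])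
  have hu1 : u ≠ 1 := fun h1 => hz1 (by rw [← Units.val_mk0 hz0, ← hu, h1, Units.val_one])
  haveI : Fact (Nat.Prime 3) := ⟨by norm_num⟩
  have horder : orderOf u = 3 := orderOf_eq_prime hu3 hu1
  have hdvd : orderOf u ∣ Fintype.card (𝓞 K ⧸ v.asIdeal)ˣ := orderOf_dvd_card
  rwa [horder, Fintype.card_units, Fintype.card_eq_nat_card, ← HeightOneSpectrum.residueCard_eq_card_quotient] at hdvd

/-- `N𝔭 ≡ 1 (mod 𝔐)` for `𝔭 ∤ 3` and `3 ∈ 𝔐`. -/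
theorem residueCard_sub_one_mem {v : HeightOneSpectrum (𝓞 K)} (h3 : (3 : 𝓞 K) ∉ v.asIdeal)
    {𝔐 : Ideal (integralClosure ℤ ℂ)} (h𝔐 : (3 : integralClosure ℤ ℂ) ∈ 𝔐) :
    ((v.residueCard : integralClosure ℤ ℂ) - 1) ∈ 𝔐 := by
  obtain ⟨k, hk⟩ := three_dvd_residueCard_sub_one v h3
  have h1 : 1 ≤ v.residueCard := (HeightOneSpectrum.one_lt_residueCard v).le
  have : (v.residueCard : integralClosure ℤ ℂ) - 1 = 3 * k := by
    have h := congrArg (fun n : ℕ => (n : integralClosure ℤ ℂ)) hk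
    simp only [Nat.cast_sub h1, Nat.cast_one, Nat.cast_mul, Nat.cast_ofNat] at h
    exact h
  rw [this]
  exact Ideal.mul_mem_right _ _ h𝔐

/-! ### The table is monic -/

/-- The five table polynomials are monic. -/
theorem monic_table (n : ℕ) (sq : Prop) [Decidable sq] :
    (if n = 4 then (X - 1) ^ 3
      else if n = 2 then (X - 1) ^ 2 * (X + 1)
      else if n = 1 then X ^ 3 - 1
      else if sq then (X - 1) * (X + 1) ^ 2
      else X ^ 3 + X ^ 2 + X + 1 : ℤ[X]).Monic := by
  split_ifs
  · exact (monic_X_sub_C 1).pow 3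
  · exact ((monic_X_sub_C 1).pow 2).mul (monic_X_add_C 1)
  · exact monic_X_pow_sub_C 1 (by norm_num)
  · exact (monic_X_sub_C 1).mul ((monic_X_add_C 1).pow 2)
  · monicity <;> norm_num

/-! ### The decl at weight `0` -/

/-- **`ResidualAutomorphyEven` with the regular-algebraic clause removed, granted cubic automorphic
induction** (`automorphicInduction_character_cubic`, JPSS 1979 II §§13–14): verbatim the route decl's
conclusion for `P = AI_{E/K}(ε)`, except `P.1.IsRegularAlgebraic`. -/
theorem residualAutomorphyEven_weightZero (hAI : automorphicInduction_character_cubic) (f : ℤ[X])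
    (hcpt : isCompact_glFiniteIntegralLevel 3 (CyclotomicField 3 ℚ)) (hdeg : f.natDegree = 4)
    (hsep : (f.map (Int.castRingHom ℚ)).Separable) (hgal : 12 ∣ Nat.card (f.map (Int.castRingHom ℚ)).Gal)
    (hreal : (f.map (Int.castRingHom ℝ)).roots.card = 4) :
    ∃ (P : CuspidalAutomorphicRepData 3 (CyclotomicField 3 ℚ) hcpt) (𝔐 : Ideal (integralClosure ℤ ℂ)),
      𝔐.IsMaximal ∧ (3 : integralClosure ℤ ℂ) ∈ 𝔐 ∧
      ∀ᶠ 𝔭 : HeightOneSpectrum (𝓞 (CyclotomicField 3 ℚ)) in cofinite,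
        ∃ (α : Multiset ℂ) (Q : Polynomial (integralClosure ℤ ℂ)),
          P.1.HasSatakeParamAt 𝔭 α ∧
          Q.map (algebraMap (integralClosure ℤ ℂ) ℂ) =
            (α.map (fun a => X - C ((𝔭.residueCard : ℂ) * a))).prod ∧
          Q.map (Ideal.Quotient.mk 𝔐) =
            (if (f.map ((Ideal.Quotient.mk 𝔭.asIdeal).comp (algebraMap ℤ (𝓞 (CyclotomicField 3 ℚ))))).roots.toFinset.card = 4
                then (X - 1) ^ 3
              else if (f.map ((Ideal.Quotient.mk 𝔭.asIdeal).comp (algebraMap ℤ (𝓞 (CyclotomicField 3 ℚ))))).roots.toFinset.card = 2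
                then (X - 1) ^ 2 * (X + 1)
              else if (f.map ((Ideal.Quotient.mk 𝔭.asIdeal).comp (algebraMap ℤ (𝓞 (CyclotomicField 3 ℚ))))).roots.toFinset.card = 1
                then X ^ 3 - 1
              else if (∃ y : 𝓞 (CyclotomicField 3 ℚ) ⧸ 𝔭.asIdeal,
                  y ^ 2 = (f.map ((Ideal.Quotient.mk 𝔭.asIdeal).comp (algebraMap ℤ (𝓞 (CyclotomicField 3 ℚ))))).discr)
                then (X - 1) * (X + 1) ^ 2
              else X ^ 3 + X ^ 2 + X + 1 : ℤ[X]).map (Int.castRingHom (integralClosure ℤ ℂ ⧸ 𝔐)) := by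
  obtain ⟨π, hπ⟩ := exists_cuspidal_satakePolynomial_eq_table hAI f hcpt hdeg hsep hgal hreal
  obtain ⟨𝔐, h𝔐, h3⟩ := Summit.Langlands.Langlands.Theorems.IrregularClassicality.Negative.exists_isMaximal_three_mem
  refine ⟨π, 𝔐, h𝔐, h3, ?_⟩
  have h3fin : ∀ᶠ 𝔭 : HeightOneSpectrum (𝓞 K) in cofinite, (3 : 𝓞 K) ∉ 𝔭.asIdeal := by
    rw [eventually_cofinite]
    simpa only [not_not] using finite_setOf_mem_asIdeal K (by norm_num : (3 : 𝓞 K) ≠ 0)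
  filter_upwards [hπ, h3fin] with v hv hv3
  obtain ⟨α, hα, hpoly⟩ := hv
  obtain ⟨Q, hQ1, hQ2⟩ := exists_Q_of_satakePolynomial_eq (monic_table _ _) hpoly 𝔐 (residueCard_sub_one_mem hv3 h3)
  exact ⟨α, Q, hα, hQ1, hQ2⟩

end Summit.Langlands.Langlands.Theorems.ResidualAutomorphyEven
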